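import Mathlib.Algebra.Group.Subgroup.Basic
import Summits.MatrixMultiplication.OmegaCensus.DihC3SqCoord

/-!
# ω-census, family (b3): the class `𝒞₂` literally — `G = C₃² ⋊_ε C` (`C` abelian acting through `±1`) carries the coordinates `Coord₂`

HONEST FRAMING (pub-omega census; verbatim): lottery ticket; floor = certified bounds/negative ranges.
Census BOOKKEEPING (prereg P-031 / conjecture C9 of the cell; pub-omega stpp-1 gen 17): discharges the hypothesis package
`DihC3Sq.Coord2 c₁ c₂ κ₁ κ₂ ε` of `DihC3SqCoord.lean` from the LITERAL description of the class `𝒞₂`: `G` is generated by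
`K = ⟨c₁, c₂⟩ ≅ C₃²` (`c₁³ = c₂³ = 1`, `c₁ c₂ = c₂ c₁`, `c₁^a c₂^b ∈ C` only for `a ≡ b ≡ 0 (mod 3)`) and an ABELIAN subgroup `C`
(`G = K·C`), every element of which centralises or inverts `K` (`γ c_i γ⁻¹ = c_i` for both `i`, or `= c_i⁻¹` for both `i`).  So the
law of the class (`DihC3SqTPP`: `9|S||T||U| ≤ 16|G|`) and C9's fourth class read literally "`G ≅ C₃² ⋊_ε C`".  Elementary; nothing
here is progress on `ω`.

PROOF (`exists_coord2_of_split`).  Normal form: `(a, b, γ) ↦ c₁^a c₂^b γ` is a bijection `ZMod 3 × ZMod 3 × C ≃ G` (surjective by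
`G = K·C`, injective by `K ∩ C = 1` in exponent form); `κ₁, κ₂` read off `a, b`, `ε(g) = +1 / −1` according as the `C`-part `γ`
centralises / inverts `c₁`.  The cocycle laws are the product of normal forms `c₁^a c₂^b γ · c₁^{a'} c₂^{b'} γ' =
c₁^{a ± a'} c₂^{b ± b'} (γ γ')`; commutators lie in `K` because the `C`-parts of `gh` and `hg` agree (`C` abelian) and `C`
normalises `K`.
-/

namespace Summit.MatrixMultiplication.OmegaCensus.DihC3Sq

variable {G : Type*} [Group G]

/-- Powers of an element with `c³ = 1` reduce `mod 3`. [folklore] -/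
theorem pow_eq_pow_mod_three {c : G} (h : c ^ 3 = 1) (n : ℕ) : c ^ n = c ^ (n % 3) := by
  conv_lhs => rw [← Nat.div_add_mod n 3, pow_add, pow_mul, h, one_pow, one_mul]

/-- Equal residues `mod 3` give equal powers of an element with `c³ = 1`. [folklore] -/
theorem pow_eq_pow_of_natCast_eq {c : G} (h : c ^ 3 = 1) {n m : ℕ} (e : (n : ZMod 3) = m) : c ^ n = c ^ m := by
  rw [pow_eq_pow_mod_three h n, pow_eq_pow_mod_three h m, (ZMod.natCast_eq_natCast_iff' n m 3).1 e]

/-- `c₁^i c₂^j ∈ K` (listed form) for `i, j < 3`. [folklore] -/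
theorem inK2_pow_pow (c₁ c₂ : G) {i j : ℕ} (hi : i < 3) (hj : j < 3) : InK2 c₁ c₂ (c₁ ^ i * c₂ ^ j) := by
  have hi' : i = 0 ∨ i = 1 ∨ i = 2 := by omega
  have hj' : j = 0 ∨ j = 1 ∨ j = 2 := by omega
  rcases hi' with rfl | rfl | rfl <;> rcases hj' with rfl | rfl | rfl <;> simp [InK2, pow_two]

section Split

variable {c₁ c₂ : G} {C : Subgroup G}

/-- Product of two `K`-words: `c₁^a c₂^b · c₁^{a'} c₂^{b'} = c₁^{a+a'} c₂^{b+b'}`. [folklore] -/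
theorem word_mul (h12 : c₁ * c₂ = c₂ * c₁) (a b a' b' : ℕ) : c₁ ^ a * c₂ ^ b * (c₁ ^ a' * c₂ ^ b') = c₁ ^ (a + a') * c₂ ^ (b + b') := by
  have hc : Commute c₂ c₁ := (h12 : Commute c₁ c₂).symm
  calc c₁ ^ a * c₂ ^ b * (c₁ ^ a' * c₂ ^ b') = c₁ ^ a * (c₂ ^ b * c₁ ^ a') * c₂ ^ b' := by group
    _ = c₁ ^ a * (c₁ ^ a' * c₂ ^ b) * c₂ ^ b' := by rw [(hc.pow_pow b a').eq]
    _ = c₁ ^ (a + a') * c₂ ^ (b + b') := by rw [pow_add, pow_add]; group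

/-- `c₁³ = 1` as a power. [folklore] -/
theorem c1_pow_three' (h1 : c₁ * c₁ * c₁ = 1) : c₁ ^ 3 = 1 := by rw [pow_succ, pow_two]; exact h1

/-- `c₂³ = 1` as a power. [folklore] -/
theorem c2_pow_three' (h2 : c₂ * c₂ * c₂ = 1) : c₂ ^ 3 = 1 := by rw [pow_succ, pow_two]; exact h2

/-- Conjugating a `K`-word by an element that centralises `c₁, c₂`. [folklore] -/
theorem conj_word_of_fix {γ : G} (e1 : γ * c₁ * γ⁻¹ = c₁) (e2 : γ * c₂ * γ⁻¹ = c₂) (a b : ℕ) :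
    γ * (c₁ ^ a * c₂ ^ b) * γ⁻¹ = c₁ ^ a * c₂ ^ b := by
  calc γ * (c₁ ^ a * c₂ ^ b) * γ⁻¹ = (γ * c₁ * γ⁻¹) ^ a * (γ * c₂ * γ⁻¹) ^ b := by rw [conj_pow, conj_pow]; group
    _ = c₁ ^ a * c₂ ^ b := by rw [e1, e2]

/-- Conjugating a `K`-word by an element that inverts `c₁, c₂` doubles the exponents. [folklore] -/
theorem conj_word_of_inv (h1 : c₁ * c₁ * c₁ = 1) (h2 : c₂ * c₂ * c₂ = 1) {γ : G} (e1 : γ * c₁ * γ⁻¹ = c₁⁻¹) (e2 : γ * c₂ * γ⁻¹ = c₂⁻¹) (a b : ℕ) :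
    γ * (c₁ ^ a * c₂ ^ b) * γ⁻¹ = c₁ ^ (2 * a) * c₂ ^ (2 * b) := by
  have i1 : c₁⁻¹ = c₁ ^ 2 := inv_eq_of_mul_eq_one_right (by rw [pow_two, ← mul_assoc]; exact h1)
  have i2 : c₂⁻¹ = c₂ ^ 2 := inv_eq_of_mul_eq_one_right (by rw [pow_two, ← mul_assoc]; exact h2)
  calc γ * (c₁ ^ a * c₂ ^ b) * γ⁻¹ = (γ * c₁ * γ⁻¹) ^ a * (γ * c₂ * γ⁻¹) ^ b := by rw [conj_pow, conj_pow]; group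
    _ = c₁ ^ (2 * a) * c₂ ^ (2 * b) := by rw [e1, e2, i1, i2, ← pow_mul, ← pow_mul]

/-- **Uniqueness of the normal form** `c₁^a c₂^b γ` (`γ ∈ C`): exponents agree `mod 3` and the `C`-parts agree. [folklore] -/
theorem nf_unique (h1 : c₁ * c₁ * c₁ = 1) (h2 : c₂ * c₂ * c₂ = 1) (h12 : c₁ * c₂ = c₂ * c₁)
    (hKC : ∀ a b : ℕ, c₁ ^ a * c₂ ^ b ∈ C → (a : ZMod 3) = 0 ∧ (b : ZMod 3) = 0) {a b a' b' : ℕ} {γ γ' : G} (hγ : γ ∈ C) (hγ' : γ' ∈ C)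
    (e : c₁ ^ a * c₂ ^ b * γ = c₁ ^ a' * c₂ ^ b' * γ') : (a : ZMod 3) = a' ∧ (b : ZMod 3) = b' ∧ γ = γ' := by
  -- `c₁^{2a'+a} c₂^{2b'+b} = γ' γ⁻¹ ∈ C`
  have hw : c₁ ^ (2 * a' + a) * c₂ ^ (2 * b' + b) = γ' * γ⁻¹ := by
    have e3a : c₁ ^ (2 * a' + a') = 1 := by
      rw [show 2 * a' + a' = 3 * a' by ring, pow_mul, c1_pow_three' h1, one_pow]
    have e3b : c₂ ^ (2 * b' + b') = 1 := by
      rw [show 2 * b' + b' = 3 * b' by ring, pow_mul, c2_pow_three' h2, one_pow]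
    calc c₁ ^ (2 * a' + a) * c₂ ^ (2 * b' + b) = c₁ ^ (2 * a') * c₂ ^ (2 * b') * (c₁ ^ a * c₂ ^ b) := by
          rw [word_mul h12]
      _ = c₁ ^ (2 * a') * c₂ ^ (2 * b') * (c₁ ^ a * c₂ ^ b * γ) * γ⁻¹ := by group
      _ = c₁ ^ (2 * a') * c₂ ^ (2 * b') * (c₁ ^ a' * c₂ ^ b') * (γ' * γ⁻¹) := by rw [e]; group
      _ = c₁ ^ (2 * a' + a') * c₂ ^ (2 * b' + b') * (γ' * γ⁻¹) := by rw [word_mul h12]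
      _ = γ' * γ⁻¹ := by rw [e3a, e3b, one_mul, one_mul]
  have hmem : c₁ ^ (2 * a' + a) * c₂ ^ (2 * b' + b) ∈ C := by
    rw [hw]; exact C.mul_mem hγ' (C.inv_mem hγ)
  obtain ⟨za, zb⟩ := hKC _ _ hmem
  push_cast at za zb
  have h3 : (3 : ZMod 3) = 0 := by decide
  have ea : (a : ZMod 3) = a' := by linear_combination za - (a' : ZMod 3) * h3
  have eb : (b : ZMod 3) = b' := by linear_combination zb - (b' : ZMod 3) * h3
  refine ⟨ea, eb, ?_⟩
  have ew : c₁ ^ a * c₂ ^ b = c₁ ^ a' * c₂ ^ b' := by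
    rw [pow_eq_pow_of_natCast_eq (c1_pow_three' h1) ea, pow_eq_pow_of_natCast_eq (c2_pow_three' h2) eb]
  rw [ew] at e
  exact mul_left_cancel e

/-- **The literal class `𝒞₂` carries coordinates.** If `G = K·C` with `K = ⟨c₁, c₂⟩ ≅ C₃²` meeting the abelian subgroup `C`
trivially and every element of `C` centralising or inverting `K`, then `Coord2 c₁ c₂ κ₁ κ₂ ε` holds for suitable
`κ₁ κ₂ ε : G → ZMod 3`. [folklore] -/
theorem exists_coord2_of_split (h1 : c₁ * c₁ * c₁ = 1) (h2 : c₂ * c₂ * c₂ = 1) (h12 : c₁ * c₂ = c₂ * c₁)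
    (hC : ∀ γ ∈ C, ∀ δ ∈ C, γ * δ = δ * γ) (hKC : ∀ a b : ℕ, c₁ ^ a * c₂ ^ b ∈ C → (a : ZMod 3) = 0 ∧ (b : ZMod 3) = 0)
    (hgen : ∀ g : G, ∃ (a b : ℕ) (γ : G), γ ∈ C ∧ g = c₁ ^ a * c₂ ^ b * γ)
    (hact : ∀ γ ∈ C, (γ * c₁ * γ⁻¹ = c₁ ∧ γ * c₂ * γ⁻¹ = c₂) ∨ (γ * c₁ * γ⁻¹ = c₁⁻¹ ∧ γ * c₂ * γ⁻¹ = c₂⁻¹)) :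
    ∃ κ₁ κ₂ ε : G → ZMod 3, Coord2 c₁ c₂ κ₁ κ₂ ε := by
  classical
  have h13 := c1_pow_three' h1
  have h23 := c2_pow_three' h2
  -- `c₁ ∉ C`, hence `c₁⁻¹ ≠ c₁`
  have hc1C : c₁ ∉ C := fun hm => by
    have := (hKC 1 0 (by simpa using hm)).1
    exact absurd this (by decide)
  have hinv_ne : c₁⁻¹ ≠ c₁ := fun e => by
    have e2 : c₁ * c₁ = 1 := by
      calc c₁ * c₁ = c₁⁻¹ * c₁ := by rw [e]
        _ = 1 := inv_mul_cancel c₁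
    have e1 : c₁ = 1 := by
      calc c₁ = c₁ * c₁ * c₁ * (c₁ * c₁)⁻¹ := by group
        _ = 1 := by rw [h1, e2]; group
    exact hc1C (e1 ▸ C.one_mem)
  -- the normal-form bijection
  let f : ZMod 3 × ZMod 3 × C → G := fun t => c₁ ^ (t.1.val) * c₂ ^ (t.2.1.val) * (t.2.2 : G)
  have finj : Function.Injective f := by
    rintro ⟨a, b, ⟨γ, hγ⟩⟩ ⟨a', b', ⟨γ', hγ'⟩⟩ e
    change c₁ ^ a.val * c₂ ^ b.val * γ = c₁ ^ a'.val * c₂ ^ b'.val * γ' at e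
    obtain ⟨ea, eb, eγ⟩ := nf_unique h1 h2 h12 hKC hγ hγ' e
    rw [ZMod.natCast_zmod_val, ZMod.natCast_zmod_val] at ea eb
    subst eγ; subst ea; subst eb; rfl
  have fsurj : Function.Surjective f := by
    intro g
    obtain ⟨a, b, γ, hγ, rfl⟩ := hgen g
    refine ⟨((a : ZMod 3), (b : ZMod 3), ⟨γ, hγ⟩), ?_⟩
    simp only [f, ZMod.val_natCast]
    rw [← pow_eq_pow_mod_three h13, ← pow_eq_pow_mod_three h23]
  let eqv := Equiv.ofBijective f ⟨finj, fsurj⟩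
  have hnf : ∀ (a b : ℕ) (γ : G) (hγ : γ ∈ C), eqv.symm (c₁ ^ a * c₂ ^ b * γ) = ((a : ZMod 3), (b : ZMod 3), ⟨γ, hγ⟩) := by
    intro a b γ hγ
    apply eqv.injective
    rw [Equiv.apply_symm_apply]
    show c₁ ^ a * c₂ ^ b * γ = c₁ ^ ((a : ZMod 3).val) * c₂ ^ ((b : ZMod 3).val) * γ
    rw [ZMod.val_natCast, ZMod.val_natCast, ← pow_eq_pow_mod_three h13, ← pow_eq_pow_mod_three h23]
  -- the coordinates
  let κ₁ : G → ZMod 3 := fun g => (eqv.symm g).1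
  let κ₂ : G → ZMod 3 := fun g => (eqv.symm g).2.1
  let γof : G → G := fun g => ((eqv.symm g).2.2 : G)
  let ε : G → ZMod 3 := fun g => if γof g * c₁ * (γof g)⁻¹ = c₁ then 1 else -1
  -- values on normal forms
  have hk1 : ∀ (a b : ℕ) (γ : G), γ ∈ C → κ₁ (c₁ ^ a * c₂ ^ b * γ) = (a : ZMod 3) := by
    intro a b γ hγ; simp only [κ₁, hnf a b γ hγ]
  have hk2 : ∀ (a b : ℕ) (γ : G), γ ∈ C → κ₂ (c₁ ^ a * c₂ ^ b * γ) = (b : ZMod 3) := by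
    intro a b γ hγ; simp only [κ₂, hnf a b γ hγ]
  have hγof : ∀ (a b : ℕ) (γ : G), γ ∈ C → γof (c₁ ^ a * c₂ ^ b * γ) = γ := by
    intro a b γ hγ; simp only [γof, hnf a b γ hγ]
  have heps_fix : ∀ (a b : ℕ) (γ : G), γ ∈ C → γ * c₁ * γ⁻¹ = c₁ → ε (c₁ ^ a * c₂ ^ b * γ) = 1 := by
    intro a b γ hγ e; simp only [ε, hγof a b γ hγ, e, if_true]
  have heps_inv : ∀ (a b : ℕ) (γ : G), γ ∈ C → γ * c₁ * γ⁻¹ = c₁⁻¹ → ε (c₁ ^ a * c₂ ^ b * γ) = -1 := by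
    intro a b γ hγ e; simp only [ε, hγof a b γ hγ, e, if_neg hinv_ne]
  -- every element in normal form with natural exponents
  have hnat : ∀ g : G, ∃ (a b : ℕ) (γ : G), γ ∈ C ∧ g = c₁ ^ a * c₂ ^ b * γ := hgen
  have h2neg : (2 : ZMod 3) = -1 := by decide
  refine ⟨κ₁, κ₂, ε, h1, h2, h12, ?_, ?_, ?_, ?_, ?_, ?_, ?_, ?_, ?_⟩
  · -- κ₁ c₁ = 1
    have := hk1 1 0 1 C.one_mem; simpa using this
  · -- κ₂ c₁ = 0
    have := hk2 1 0 1 C.one_mem; simpa using this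
  · -- κ₁ c₂ = 0
    have := hk1 0 1 1 C.one_mem; simpa using this
  · -- κ₂ c₂ = 1
    have := hk2 0 1 1 C.one_mem; simpa using this
  · -- ε = ±1
    intro g; simp only [ε]; split_ifs
    · exact Or.inl rfl
    · exact Or.inr rfl
  · -- κ₁ (g k) = κ₁ g + ε g κ₁ k
    intro g k
    obtain ⟨a, b, γ, hγ, rfl⟩ := hnat g
    obtain ⟨a', b', γ', hγ', rfl⟩ := hnat k
    rcases hact γ hγ with ⟨e1, e2⟩ | ⟨e1, e2⟩
    · have hprod : c₁ ^ a * c₂ ^ b * γ * (c₁ ^ a' * c₂ ^ b' * γ') = c₁ ^ (a + a') * c₂ ^ (b + b') * (γ * γ') := by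
        calc c₁ ^ a * c₂ ^ b * γ * (c₁ ^ a' * c₂ ^ b' * γ') = c₁ ^ a * c₂ ^ b * (γ * (c₁ ^ a' * c₂ ^ b') * γ⁻¹) * (γ * γ') := by
              group
          _ = c₁ ^ (a + a') * c₂ ^ (b + b') * (γ * γ') := by rw [conj_word_of_fix e1 e2, word_mul h12]
      rw [hprod, hk1 _ _ _ (C.mul_mem hγ hγ'), hk1 _ _ _ hγ, hk1 _ _ _ hγ', heps_fix _ _ _ hγ e1]; push_cast; ring
    · have hprod : c₁ ^ a * c₂ ^ b * γ * (c₁ ^ a' * c₂ ^ b' * γ') = c₁ ^ (a + 2 * a') * c₂ ^ (b + 2 * b') * (γ * γ') := by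
        calc c₁ ^ a * c₂ ^ b * γ * (c₁ ^ a' * c₂ ^ b' * γ') = c₁ ^ a * c₂ ^ b * (γ * (c₁ ^ a' * c₂ ^ b') * γ⁻¹) * (γ * γ') := by
              group
          _ = c₁ ^ (a + 2 * a') * c₂ ^ (b + 2 * b') * (γ * γ') := by rw [conj_word_of_inv h1 h2 e1 e2, word_mul h12]
      rw [hprod, hk1 _ _ _ (C.mul_mem hγ hγ'), hk1 _ _ _ hγ, hk1 _ _ _ hγ', heps_inv _ _ _ hγ e1]; push_cast
      linear_combination (a' : ZMod 3) * h2neg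
  · -- κ₂ (g k) = κ₂ g + ε g κ₂ k
    intro g k
    obtain ⟨a, b, γ, hγ, rfl⟩ := hnat g
    obtain ⟨a', b', γ', hγ', rfl⟩ := hnat k
    rcases hact γ hγ with ⟨e1, e2⟩ | ⟨e1, e2⟩
    · have hprod : c₁ ^ a * c₂ ^ b * γ * (c₁ ^ a' * c₂ ^ b' * γ') = c₁ ^ (a + a') * c₂ ^ (b + b') * (γ * γ') := by
        calc c₁ ^ a * c₂ ^ b * γ * (c₁ ^ a' * c₂ ^ b' * γ') = c₁ ^ a * c₂ ^ b * (γ * (c₁ ^ a' * c₂ ^ b') * γ⁻¹) * (γ * γ') := by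
              group
          _ = c₁ ^ (a + a') * c₂ ^ (b + b') * (γ * γ') := by rw [conj_word_of_fix e1 e2, word_mul h12]
      rw [hprod, hk2 _ _ _ (C.mul_mem hγ hγ'), hk2 _ _ _ hγ, hk2 _ _ _ hγ', heps_fix _ _ _ hγ e1]; push_cast; ring
    · have hprod : c₁ ^ a * c₂ ^ b * γ * (c₁ ^ a' * c₂ ^ b' * γ') = c₁ ^ (a + 2 * a') * c₂ ^ (b + 2 * b') * (γ * γ') := by
        calc c₁ ^ a * c₂ ^ b * γ * (c₁ ^ a' * c₂ ^ b' * γ') = c₁ ^ a * c₂ ^ b * (γ * (c₁ ^ a' * c₂ ^ b') * γ⁻¹) * (γ * γ') := by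
              group
          _ = c₁ ^ (a + 2 * a') * c₂ ^ (b + 2 * b') * (γ * γ') := by rw [conj_word_of_inv h1 h2 e1 e2, word_mul h12]
      rw [hprod, hk2 _ _ _ (C.mul_mem hγ hγ'), hk2 _ _ _ hγ, hk2 _ _ _ hγ', heps_inv _ _ _ hγ e1]; push_cast
      linear_combination (b' : ZMod 3) * h2neg
  · -- ε (g k) = ε g ε k
    intro g k
    obtain ⟨a, b, γ, hγ, rfl⟩ := hnat g
    obtain ⟨a', b', γ', hγ', rfl⟩ := hnat k
    -- the product's `C`-part is `γ γ'`
    have hprod : ∃ p q : ℕ, c₁ ^ a * c₂ ^ b * γ * (c₁ ^ a' * c₂ ^ b' * γ') = c₁ ^ p * c₂ ^ q * (γ * γ') := by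
      rcases hact γ hγ with ⟨e1, e2⟩ | ⟨e1, e2⟩
      · exact ⟨a + a', b + b', by
          calc c₁ ^ a * c₂ ^ b * γ * (c₁ ^ a' * c₂ ^ b' * γ') = c₁ ^ a * c₂ ^ b * (γ * (c₁ ^ a' * c₂ ^ b') * γ⁻¹) * (γ * γ') := by
                group
            _ = c₁ ^ (a + a') * c₂ ^ (b + b') * (γ * γ') := by rw [conj_word_of_fix e1 e2, word_mul h12]⟩
      · exact ⟨a + 2 * a', b + 2 * b', by
          calc c₁ ^ a * c₂ ^ b * γ * (c₁ ^ a' * c₂ ^ b' * γ') = c₁ ^ a * c₂ ^ b * (γ * (c₁ ^ a' * c₂ ^ b') * γ⁻¹) * (γ * γ') := by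
                group
            _ = c₁ ^ (a + 2 * a') * c₂ ^ (b + 2 * b') * (γ * γ') := by rw [conj_word_of_inv h1 h2 e1 e2, word_mul h12]⟩
    obtain ⟨p, q, hpq⟩ := hprod
    have hγγ : γ * γ' ∈ C := C.mul_mem hγ hγ'
    have conj_mul : γ * γ' * c₁ * (γ * γ')⁻¹ = γ * (γ' * c₁ * γ'⁻¹) * γ⁻¹ := by group
    rcases hact γ hγ with ⟨e1, -⟩ | ⟨e1, -⟩ <;> rcases hact γ' hγ' with ⟨f1, -⟩ | ⟨f1, -⟩
    · have e : γ * γ' * c₁ * (γ * γ')⁻¹ = c₁ := by rw [conj_mul, f1, e1]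
      rw [hpq, heps_fix _ _ _ hγγ e, heps_fix _ _ _ hγ e1, heps_fix _ _ _ hγ' f1]; ring
    · have e : γ * γ' * c₁ * (γ * γ')⁻¹ = c₁⁻¹ := by
        rw [conj_mul, f1]
        calc γ * c₁⁻¹ * γ⁻¹ = (γ * c₁ * γ⁻¹)⁻¹ := by group
          _ = c₁⁻¹ := by rw [e1]
      rw [hpq, heps_inv _ _ _ hγγ e, heps_fix _ _ _ hγ e1, heps_inv _ _ _ hγ' f1]; ring
    · have e : γ * γ' * c₁ * (γ * γ')⁻¹ = c₁⁻¹ := by rw [conj_mul, f1, e1]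
      rw [hpq, heps_inv _ _ _ hγγ e, heps_inv _ _ _ hγ e1, heps_fix _ _ _ hγ' f1]; ring
    · have e : γ * γ' * c₁ * (γ * γ')⁻¹ = c₁ := by
        rw [conj_mul, f1]
        calc γ * c₁⁻¹ * γ⁻¹ = (γ * c₁ * γ⁻¹)⁻¹ := by group
          _ = c₁ := by rw [e1, inv_inv]
      rw [hpq, heps_fix _ _ _ hγγ e, heps_inv _ _ _ hγ e1, heps_inv _ _ _ hγ' f1]; ring
  · -- commutators lie in `K`
    intro x y
    refine ⟨(y * x)⁻¹ * (x * y), ?_, by group⟩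
    obtain ⟨a, b, γ, hγ, rfl⟩ := hnat x
    obtain ⟨a', b', γ', hγ', rfl⟩ := hnat y
    -- both products have `C`-part `γ γ' = γ' γ`
    have nfx : ∀ {γ₀ : G}, γ₀ ∈ C → ∀ a₀ b₀ a₁ b₁ : ℕ, ∃ p q : ℕ,
        c₁ ^ a₀ * c₂ ^ b₀ * γ₀ * (c₁ ^ a₁ * c₂ ^ b₁) = c₁ ^ p * c₂ ^ q * γ₀ := by
      intro γ₀ hγ₀ a₀ b₀ a₁ b₁
      rcases hact γ₀ hγ₀ with ⟨e1, e2⟩ | ⟨e1, e2⟩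
      · exact ⟨a₀ + a₁, b₀ + b₁, by
          calc c₁ ^ a₀ * c₂ ^ b₀ * γ₀ * (c₁ ^ a₁ * c₂ ^ b₁) = c₁ ^ a₀ * c₂ ^ b₀ * (γ₀ * (c₁ ^ a₁ * c₂ ^ b₁) * γ₀⁻¹) * γ₀ := by group
            _ = c₁ ^ (a₀ + a₁) * c₂ ^ (b₀ + b₁) * γ₀ := by rw [conj_word_of_fix e1 e2, word_mul h12]⟩
      · exact ⟨a₀ + 2 * a₁, b₀ + 2 * b₁, by
          calc c₁ ^ a₀ * c₂ ^ b₀ * γ₀ * (c₁ ^ a₁ * c₂ ^ b₁) = c₁ ^ a₀ * c₂ ^ b₀ * (γ₀ * (c₁ ^ a₁ * c₂ ^ b₁) * γ₀⁻¹) * γ₀ := by group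
            _ = c₁ ^ (a₀ + 2 * a₁) * c₂ ^ (b₀ + 2 * b₁) * γ₀ := by rw [conj_word_of_inv h1 h2 e1 e2, word_mul h12]⟩
    obtain ⟨p, q, hxy⟩ := nfx hγ a b a' b'
    obtain ⟨r, s, hyx⟩ := nfx hγ' a' b' a b
    have exy : c₁ ^ a * c₂ ^ b * γ * (c₁ ^ a' * c₂ ^ b' * γ') = c₁ ^ p * c₂ ^ q * (γ * γ') := by
      rw [← mul_assoc, hxy]; group
    have eyx : c₁ ^ a' * c₂ ^ b' * γ' * (c₁ ^ a * c₂ ^ b * γ) = c₁ ^ r * c₂ ^ s * (γ * γ') := by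
      rw [← mul_assoc, hyx, hC γ hγ γ' hγ']; group
    -- the quotient word `(yx)⁻¹(xy) = δ · c₁^{2r+p} c₂^{2s+q} · δ⁻¹`, `δ = (γ γ')⁻¹ ∈ C`
    have hW_inv : ∀ r s : ℕ, (c₁ ^ r * c₂ ^ s)⁻¹ = c₁ ^ (2 * r) * c₂ ^ (2 * s) := by
      intro r s
      apply inv_eq_of_mul_eq_one_right
      rw [word_mul h12, show r + 2 * r = 3 * r by ring, show s + 2 * s = 3 * s by ring, pow_mul, pow_mul, h13, h23,
        one_pow, one_pow, one_mul]
    have hδC : (γ * γ')⁻¹ ∈ C := C.inv_mem (C.mul_mem hγ hγ')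
    have hu : (c₁ ^ a' * c₂ ^ b' * γ' * (c₁ ^ a * c₂ ^ b * γ))⁻¹ * (c₁ ^ a * c₂ ^ b * γ * (c₁ ^ a' * c₂ ^ b' * γ')) =
        (γ * γ')⁻¹ * (c₁ ^ (2 * r + p) * c₂ ^ (2 * s + q)) * (γ * γ')⁻¹⁻¹ := by
      rw [exy, eyx, ← word_mul h12 (2 * r) (2 * s) p q, ← hW_inv]; group
    rw [hu]
    rcases hact _ hδC with ⟨e1, e2⟩ | ⟨e1, e2⟩
    · rw [conj_word_of_fix e1 e2, pow_eq_pow_mod_three h13 (2 * r + p), pow_eq_pow_mod_three h23 (2 * s + q)]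
      exact inK2_pow_pow c₁ c₂ (Nat.mod_lt _ (by norm_num)) (Nat.mod_lt _ (by norm_num))
    · rw [conj_word_of_inv h1 h2 e1 e2, pow_eq_pow_mod_three h13 (2 * (2 * r + p)),
        pow_eq_pow_mod_three h23 (2 * (2 * s + q))]
      exact inK2_pow_pow c₁ c₂ (Nat.mod_lt _ (by norm_num)) (Nat.mod_lt _ (by norm_num))

end Split

end Summit.MatrixMultiplication.OmegaCensus.DihC3Sq
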